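import Mathlib
import Summits.Langlands.Langlands.Theorems.QuadraticWindowHostInducedRepMemberSatakeData
import Summits.Langlands.Langlands.Theorems.QuadraticWindowHostInducedRepMemberParity

/-!
# Sub-stub `stub_memberSatake` of the member statement (stub `stub_package`, line
# `one-transparent-pane`, crux `Summit.Langlands.Langlands.Theses.QuadraticWindow.HostInducedRep`,
# item stmt-Langlands-10902) — helper file 4: conjugate self-duality of `τ' = Π_K ⊗ ψ₀` and the
# dictionary almost everywhere

LOG (wave-3 worker `stub_memberSatake`, 2026-08-16).  FACT-FREE (theorems only), on top of the a.e.
Satake data `eventually_memberData` of helper file 3.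

* §3 `isConjSelfDualAE_tau`: `Sat(τ', cK u) = Sat(τ', u)⁻¹` a.e. — at `u ≠ cK u`:
  `ψ₀(ϖ_u)ψ₀(ϖ_{cu}) = χ₀(ϖ_v) q_v^{-k} = θ_v μ(ϖ_v)` with `μ(ϖ_v) = 1` (`v` split in `F` too) or
  `B_v = -B_v` (`v` inert in `F`) (landed `map_mul_eq_map_inv_of_mul_eq`); at `u = cK u`:
  `ψ₀(ϖ_u)² = θ_v²` (landed `map_pow_map_inv`, `map_mul_eq_map_inv_self`).
* §4 `memberDict_ae`: the dictionary clause of `MemberDict` at almost every place (induced parameter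
  of the twisted guard family, a.e. base change and twist, landed `dictionary_powers`).
[cite: ArthurClozelAMS120, Ch. 3 Def. 6.1, (6.1)–(6.2)]
-/

open scoped BigOperators Polynomial Classical
open Filter Set Polynomial IsDedekindDomain NumberField
open Literature.NumberTheory.Automorphic Literature.NumberTheory.GaloisRepresentations
open Literature.NumberTheory.QuadraticForms Literature.NumberTheory.QuadraticForms.QuadraticExtension
open Summit.Langlands.Langlands.Theorems.HostInducedRep.GrsExplicitDescent
open Summit.Langlands.Langlands.Theorems.HostInducedRep.Negative

-- `Summit.Langlands.Langlands.…` (summit = sub-problem name, D-0017 layout) trips `dupNamespace`.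
set_option linter.dupNamespace false

noncomputable section

namespace Summit.Langlands.Langlands.Theorems.HostInducedRep.OneTransparentPane
section Dual

variable {F₀ F K : Type} [Field F₀] [NumberField F₀] [Field F] [NumberField F] [Algebra F₀ F]
  [Field K] [NumberField K] [Algebra F₀ K]

/-! ## §3 Conjugate self-duality of `τ'` almost everywhere -/

/-- **`τ' = Π_K ⊗ ψ₀` is conjugate self-dual a.e. w.r.t. `cK`**: `Sat(τ', cK u) = Sat(τ', u)⁻¹` at
almost every place `u` of `K` (see the module docstring, §3). [cite: ArthurClozelAMS120, Ch. 3 Def. 6.1, (6.1)–(6.2)] -/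
theorem isConjSelfDualAE_tau (hdeg : Module.finrank F₀ F = 2) {τ : F ≃ₐ[F₀] F} (hτ : τ ≠ 1)
    (h2K : Module.finrank F₀ K = 2) {cK : K ≃ₐ[F₀] K} (hcK : cK ≠ 1) {n : ℕ}
    {hcpt : isCompact_glFiniteIntegralLevel n F}
    (π : CuspidalAutomorphicRepData n F hcpt) (e : FramedGaloisRep F₀ ℂ 1) (k : ℤ)
    (hpol : ∀ᶠ w in cofinite, ∀ (α β : Multiset ℂ) (c : ℂ), π.1.HasSatakeParamAt w α →
      π.1.HasSatakeParamAt (τ • w) β → e.HasFrobCharpolyAt (w.under (𝓞 F₀)) (X - C c) →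
      β = α.map (fun a ↦ a⁻¹ * (c * ((w.under (𝓞 F₀)).residueCard : ℂ) ^ k) ^
        w.asIdeal.inertiaDeg (𝓞 F₀)))
    {χe μ ω₀ : HeckeCharacter F₀} {ω : HeckeCharacter F} (hfin : ω.IsFiniteOrder)
    (hχe : ∀ v : HeightOneSpectrum (𝓞 F₀), e.IsUnramifiedAt v →
      χe.IsUnramifiedAt v ∧ e.HasFrobCharpolyAt v (X - C (χe.valueAtUniformizer v)))
    (hω₀ : ∀ x, ω₀ x = ω (AdeleRing.ideleBaseChange F₀ F x)) (hμ : MuHyp F K μ)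
    {ψu νk : HeckeCharacter K}
    (hψures : ∀ x, ψu (AdeleRing.ideleBaseChange F₀ K x) = ((χe * ω₀)⁻¹ * μ) x)
    (hνk : ∀ x : ideleGroup K, ((νk x : ℂˣ) : ℂ) = ((ideleNorm x : ℝ) : ℂ) ^ ((k : ℂ) / 2))
    {hF₀ : isCompact_glFiniteIntegralLevel (2 * n) F₀} {hK : isCompact_glFiniteIntegralLevel (2 * n) K}
    {Pind : AutomorphicRepData (AutomorphyDatum.gl (2 * n) F₀ hF₀)}
    {PiK τ' : AutomorphicRepData (AutomorphyDatum.gl (2 * n) K hK)}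
    (hAI : IsAutomorphicInductionAlong (π.twist ω hfin).1 Pind) (hBC : IsWeakBaseChangeLiftAE Pind PiK)
    (hW : τ'.W = PiK.W.map (mulChar (detTwist (2 * n) (ψu * νk))))
    (hW' : τ'.W' = PiK.W'.map (mulChar (detTwist (2 * n) (ψu * νk)))) :
    τ'.IsConjSelfDualAE cK := by
  have hD := eventually_memberData hdeg hτ π e k hpol hfin hχe hω₀ hμ hψures hAI hBC hW hW'
  change ∀ᶠ u : HeightOneSpectrum (𝓞 K) in cofinite, ∀ α' β' : Multiset ℂ, τ'.HasSatakeParamAt u α' →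
    τ'.HasSatakeParamAt (cK • u) β' → β' = α'.map (·⁻¹)
  filter_upwards [eventually_under (E := K) hD] with u hu α' β' hα' hβ'
  obtain ⟨α, B, hv1, hv2, -, -, hBi, hinv, hχ₀v, hμ2, hμ1, hKu, hres, -⟩ := hu (u.under (𝓞 F₀)) rfl
  set v := u.under (𝓞 F₀) with hvdef
  set θ : ℂ := (χe.valueAtUniformizer v * (v.residueCard : ℂ) ^ k * ω₀.valueAtUniformizer v)⁻¹ with hθ
  have hcuv : (cK • u).under (𝓞 F₀) = v := HeightOneSpectrum.under_algEquiv_smul F₀ K cK u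
  obtain ⟨-, -, hτ'u⟩ := hKu u rfl
  obtain ⟨-, -, hτ'cu⟩ := hKu (cK • u) hcuv
  have hψpair := restrict_pair h2K hcK hres (rfl : u.under (𝓞 F₀) = v)
  -- `ψ₀(ϖ_u) = ψu(ϖ_u) q_u^{-k/2}`
  have hs : ∀ u' : HeightOneSpectrum (𝓞 K), (ψu * νk).valueAtUniformizer u' =
      ψu.valueAtUniformizer u' * (u'.residueCard : ℂ) ^ (-((k : ℂ) / 2)) := fun u' ↦
    valueAtUniformizer_mul_normPow hνk u'
  have hs0 : ∀ u' : HeightOneSpectrum (𝓞 K), (ψu * νk).valueAtUniformizer u' ≠ 0 := fun u' ↦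
    Units.ne_zero _
  by_cases hcu : cK • u = u
  · -- `u` is `cK`-fixed (`v` inert in `K`, `f(u|v) = 2`): `Sat(τ', u)` is self-inverse
    rw [hcu] at hβ'
    have e1 : β' = α' := τ'.hasSatakeParamAt_unique_holds hβ' hα'
    have hf : u.asIdeal.inertiaDeg (𝓞 F₀) = 2 := inertiaDeg_eq_two_of_smul_eq_of_isUnramifiedIn h2K hcK hcu hv2
    have hq : u.residueCard = v.residueCard ^ 2 := by rw [residueCard_eq_pow_inertiaDeg (F := F₀) u, hf]
    rw [e1, τ'.hasSatakeParamAt_unique_holds hα' hτ'u, hf]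
    have hB2 := map_pow_map_inv hinv 2
    have hsu : (ψu * νk).valueAtUniformizer u ^ 2 = θ ^ 2 := by
      rw [hs, ← hψpair.2 hcu, hχ₀v, hq, mul_pow, mul_pow, cpow_neg_half_sq_sq, hμ2, hθ, mul_inv, mul_inv,
        mul_inv]
      have hqv : (v.residueCard : ℂ) ^ k ≠ 0 :=
        zpow_ne_zero _ (Nat.cast_ne_zero.mpr (zero_lt_one.trans v.one_lt_residueCard).ne')
      field_simp
    have key := map_mul_eq_map_inv_self hB2 (hs0 u) hsu
    rw [show (B.map (· ^ 2)).map ((ψu * νk).valueAtUniformizer u * ·) =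
        (B.map (· ^ 2)).map (· * (ψu * νk).valueAtUniformizer u) from
      Multiset.map_congr rfl fun b _ ↦ mul_comm _ _, key]
  · -- `u ≠ cK u` (`v` split in `K`, `f = 1`): `ψ₀(ϖ_u) ψ₀(ϖ_{cu}) = θ_v μ(ϖ_v)`
    have hf : u.asIdeal.inertiaDeg (𝓞 F₀) = 1 := HeightOneSpectrum.inertiaDeg_eq_one_of_smul_ne h2K hcu
    have hf' : (cK • u).asIdeal.inertiaDeg (𝓞 F₀) = 1 := by
      rw [HeightOneSpectrum.inertiaDeg_algEquiv_smul, hf]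
    have hqu : u.residueCard = v.residueCard := by
      rw [residueCard_eq_pow_inertiaDeg (F := F₀) u, hf, pow_one]
    have hqcu : (cK • u).residueCard = v.residueCard := by
      rw [residueCard_eq_pow_inertiaDeg (F := F₀) (cK • u), hcuv, hf', pow_one]
    rw [τ'.hasSatakeParamAt_unique_holds hβ' hτ'cu, τ'.hasSatakeParamAt_unique_holds hα' hτ'u, hf, hf']
    have hB1 : B.map (· ^ 1) = B := by simp
    rw [hB1]
    have hss' : (ψu * νk).valueAtUniformizer u * (ψu * νk).valueAtUniformizer (cK • u) =
        θ * μ.valueAtUniformizer v := by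
      rw [hs, hs, hqu, hqcu, mul_mul_mul_comm, ← hψpair.1 hcu, hχ₀v, ← sq, cpow_neg_half_sq, hθ, mul_inv,
        mul_inv, mul_inv]
      ring
    -- `B⁻¹ = B (θ μ(ϖ_v))`
    have hBθμ : B.map (·⁻¹) = B.map (· * (θ * μ.valueAtUniformizer v)) := by
      obtain ⟨w₀, hw₀⟩ := HeightOneSpectrum.exists_under_eq F v
      by_cases hτw : τ • w₀ = w₀
      · -- `v` inert in `F`: `B = -B` and `μ(ϖ_v) = ±1`
        obtain ⟨-, -, hcomp⟩ := induced_inert hdeg hτ hw₀ hτw hv1 hBi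
        have hneg := map_neg_eq_self_of_comp_sq hcomp
        have hμ' : μ.valueAtUniformizer v * μ.valueAtUniformizer v = 1 := by rw [← sq]; exact hμ2
        rcases mul_self_eq_one_iff.mp hμ' with h1 | h1
        · rw [h1, mul_one]; exact hinv
        · calc B.map (·⁻¹) = B.map (· * θ) := hinv
            _ = (B.map (· * (-1))).map (· * (θ * (-1))) := by
                rw [Multiset.map_map]
                exact Multiset.map_congr rfl fun b _ ↦ by simp only [Function.comp_apply]; ring
            _ = B.map (· * (θ * μ.valueAtUniformizer v)) := by rw [hneg, h1]
      · -- `v` split in `F` and in `K`: `μ(ϖ_v) = 1`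
        have hKs := ncard_primesOver_eq_two_of_smul_ne h2K hcu
        have hFs := ncard_primesOver_eq_two_of_smul_ne hdeg hτw
        rw [hw₀] at hFs
        rw [hμ1 hKs hFs, mul_one]
        exact hinv
    have key := map_mul_eq_map_inv_of_mul_eq hBθμ (hs0 u) hss'
    rw [show B.map ((ψu * νk).valueAtUniformizer (cK • u) * ·) =
        B.map (· * (ψu * νk).valueAtUniformizer (cK • u)) from Multiset.map_congr rfl fun b _ ↦ mul_comm _ _,
      show B.map ((ψu * νk).valueAtUniformizer u * ·) = B.map (· * (ψu * νk).valueAtUniformizer u) from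
        Multiset.map_congr rfl fun b _ ↦ mul_comm _ _, key]

/-! ## §4 The dictionary almost everywhere -/

/-- **The dictionary clause of a member at almost every place** (control-a.e. shape): at a.e. `u`
over a guarded `v`, `ψ₁ = ψu νk ν` is unramified and `τ'` has a Satake parameter `β` with
`arithFrobPolyOfSatake ι q_u (2n) (β ψ₁(ϖ_u)⁻¹) = ∏_{x root of hostPoly v} (X - x^{f(u∣v)})` — the induced
parameter of the twisted guard family at `v` (a.e. automorphic induction), base change and twist at `u`
(a.e.), then the landed `dictionary_powers`. [folklore] -/
theorem memberDict_ae {n : ℕ} {hcpt : isCompact_glFiniteIntegralLevel n F}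
    (π : CuspidalAutomorphicRepData n F hcpt) (eψ : FramedGaloisRep F ℂ 1) {ℓ : ℕ} [Fact ℓ.Prime]
    (ι : PadicAlgCl ℓ ≃+* ℂ) {ω : HeckeCharacter F} (hfin : ω.IsFiniteOrder)
    (hω : ∀ w : HeightOneSpectrum (𝓞 F), eψ.IsUnramifiedAt w →
      ω.IsUnramifiedAt w ∧ eψ.HasFrobCharpolyAt w (X - C (ω.valueAtUniformizer w)))
    {ψu νk ν : HeckeCharacter K} {z : ℂ}
    (hνk : ∀ x : ideleGroup K, ((νk x : ℂˣ) : ℂ) = ((ideleNorm x : ℝ) : ℂ) ^ z)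
    (hν : ∀ x : ideleGroup K, ((ν x : ℂˣ) : ℂ) = ((ideleNorm x : ℝ) : ℂ) ^ (-(n : ℂ) / 2))
    {hF₀ : isCompact_glFiniteIntegralLevel (2 * n) F₀} {hK : isCompact_glFiniteIntegralLevel (2 * n) K}
    {Pind : AutomorphicRepData (AutomorphyDatum.gl (2 * n) F₀ hF₀)}
    {PiK τ' : AutomorphicRepData (AutomorphyDatum.gl (2 * n) K hK)}
    (hAI : IsAutomorphicInductionAlong (π.twist ω hfin).1 Pind) (hBC : IsWeakBaseChangeLiftAE Pind PiK)
    (hW : τ'.W = PiK.W.map (mulChar (detTwist (2 * n) (ψu * νk))))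
    (hW' : τ'.W' = PiK.W'.map (mulChar (detTwist (2 * n) (ψu * νk)))) :
    ∀ᶠ u : HeightOneSpectrum (𝓞 K) in cofinite,
      ∀ (v : HeightOneSpectrum (𝓞 F₀)) (α : HeightOneSpectrum (𝓞 F) → Multiset ℂ)
        (c : HeightOneSpectrum (𝓞 F) → ℂ), u.under (𝓞 F₀) = v → Guard π eψ v α c →
        (ψu * νk * ν).IsUnramifiedAt u ∧ ∃ β : Multiset ℂ, τ'.HasSatakeParamAt u β ∧
          arithFrobPolyOfSatake ι u.residueCard (2 * n)
              (β.map (fun b ↦ b * ((ψu * νk * ν).valueAtUniformizer u)⁻¹)) =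
            ((hostPoly ι n α c v).roots.map (fun x ↦ X - C (x ^ u.asIdeal.inertiaDeg (𝓞 F₀)))).prod := by
  have h8 := eventually_forall_under_eq (F := F₀) (HeckeCharacter.isUnramifiedAt_cofinite_holds ψu)
  have h10 := eventually_forall_under_eq (F := F₀) hBC
  have h11 := eventually_forall_under_eq (F := F₀)
    (AutomorphicRepData.eventually_hasSatakeParamAt_of_map_mulChar_detTwist (ψu * νk) hW hW')
  filter_upwards [eventually_under (E := K) (h8.and (hAI.and (h10.and h11)))] with u hu v α c huv hg
  have hu' := (place_under_eq_iff_asIdeal u v).mp huv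
  obtain ⟨hv8, hv9, hv10, hv11⟩ := hu v hu'
  -- the twisted guard family `(α_w c_w)_w` is the Satake family of `π ⊗ ω` above `v`
  have htw : ∀ w : HeightOneSpectrum (𝓞 F), w.asIdeal.under (𝓞 F₀) = v.asIdeal →
      (π.twist ω hfin).1.HasSatakeParamAt w ((α w).map (fun a ↦ a * c w)) := by
    intro w hw
    obtain ⟨-, hsat, hunr, hfrob⟩ := hg w ((place_under_eq_iff_asIdeal w v).mpr hw)
    obtain ⟨hωu, hωfrob⟩ := hω w hunr
    have hc : c w = ω.valueAtUniformizer w := artinAvatar_frobValue_unique hfrob hωfrob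
    have e : (α w).map (fun a ↦ a * c w) = (α w).map (ω.valueAtUniformizer w * ·) :=
      Multiset.map_congr rfl fun a _ ↦ by rw [hc, mul_comm]
    rw [e]
    exact hasSatakeParamAt_twist_at_unramified_place hsat hfin hωu
  obtain ⟨B, hB, hBi⟩ := hv9 _ htw
  have hPiK := hv10 u hu' v B hu' hB
  have hψ₀u : (ψu * νk).IsUnramifiedAt u :=
    parity_isUnramifiedAt_mul (hv8 u hu') (HeckeCharacter.IsNormTwist.isUnramifiedAt_holds ⟨_, hνk⟩ u)
  refine ⟨(isUnramifiedAt_mul_normPow_iff hν u).mpr hψ₀u, _, hv11 u hu' _ hPiK, ?_⟩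
  have hs : (ψu * νk).valueAtUniformizer u ≠ 0 := Units.ne_zero _
  have ht := valueAtUniformizer_mul_normPow_neg_half (ψ₀ := ψu * νk) hν u
  rw [show (B.map (· ^ u.asIdeal.inertiaDeg (𝓞 F₀))).map ((ψu * νk).valueAtUniformizer u * ·) =
      (B.map (· ^ u.asIdeal.inertiaDeg (𝓞 F₀))).map (· * (ψu * νk).valueAtUniformizer u) from
    Multiset.map_congr rfl fun b _ ↦ mul_comm _ _]
  exact dictionary_powers ι n α c hBi huv hs ht

end Dual

/-- **Registered anchor** of this helper file (stub registry of stmt-Langlands-10902, line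
`one-transparent-pane`, helper "Dual" for `stub_memberSatake`): `χ⁻¹(ϖ_u) χ(ϖ_u) = 1`. [folklore] -/
theorem memberSatakeDual_anchor : ∀ (K : Type) [Field K] [NumberField K] (χ : HeckeCharacter K) (u : HeightOneSpectrum (𝓞 K)), χ⁻¹.valueAtUniformizer u * χ.valueAtUniformizer u = 1 :=
  fun _ _ _ χ u ↦ by rw [HeckeCharacter.valueAtUniformizer_inv]; exact inv_mul_cancel₀ (Units.ne_zero _)

end Summit.Langlands.Langlands.Theorems.HostInducedRep.OneTransparentPane

end
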